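import Literature.MathematicalPhysics.QuantumFieldTheory.Balaban1983to89.LatticeWordStokes
import Literature.MathematicalPhysics.QuantumFieldTheory.Balaban1983to89.B10Eq27TorusAxialLog
import Literature.MathematicalPhysics.QuantumFieldTheory.Balaban1983to89.BlockAveragingZd
import HarnessLib

/-!
# Line «sandwich_discharge» on crux `HistoryTailL` (stmt-QuantumFields-19936), stub `stub_sandwichSweepGapCapped` — B6 door item (ii):
# THE COMB-LASSO STOKES LETTER `η_R`: every link of the ball, re-gauged by the comb/axial gauge at the centre, is within `(|Γ|²/4)·θ` of `1`

Cell `ym3-torus` (YM ladder rung R3 = continuum SU(2) Yang–Mills on the three-torus — a RUNG, NOT the Clay problem: not d = 4, not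
infinite volume, not a mass gap), width seat `ym-ust-19936-w5` gen 14, helper letters `--supports stmt-QuantumFields-19936`.

The frame defect of the comb-framed sweep (✓`CovariantDischargeFramedPlaquetteTransport.abs_wilsonTerm_plaq_gaugeFramed_sub_le_of_links`)
is paid by the re-gauged letters `V^{u}(b)`, `u = axialT V c` the comb/axial gauge at the centre `c` (lit `B10Eq27TorusAxialLog`); these ARE
the lasso holonomies `V(Γ_{c,b₋} ∪ b ∪ Γ_{b₊,c})` (lit ✓`holT_contourT_eq_gaugeActT`), closed words of length `|Γ_{c,b₋}| + 1 + |Γ_{c,b₊}|`,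
and the crude non-abelian lattice Stokes bound (lit ✓`LatticeWordStokes.dist1_holAt_le_of_netDisp_eq_zero`: `|𝒰(w) − 1| ≤ (|w|²/4)·δ` when
every plaquette is within `δ` of `1`) prices them.  THIS FILE is that bookkeeping (px8 g7 ARCH-S′ v2 §4 (ii), `η_R`):

* `netDisp_contourT` (the lasso word is closed), `length_contourT` (private), `l1_le_of_natAbs_le` (`|z|₁ ≤ d·r` for `‖z‖_∞ ≤ r`);
* ★★`dist1_gaugeAct_axialT_le` — `PlaqSmall δ V`, no wrap at `b` ⟹ `dist1 (V^{axialT V c}(b)) ≤ ((|Γ_{c,b₋}| + 1 + |Γ_{c,b₊}|)²/4)·δ`;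
* ★★`dist1_gaugeAct_axialT_le_of_ball` — for `b.src = c + z`, `‖z‖_∞ ≤ r`, `2(r+1) ≤` period: `dist1 (V^{axialT V c}(b)) ≤ ((2dr + 2)²/4)·δ`
  — the `η_R` of the B6 door with `R ↦ r` (`d = 3`: `(3r+1)²·δ ≤ 16r²δ` for `r ≥ 1`).

WHAT THIS IS NOT.  No sweep, no action; nothing of `stub_sandwichSweepGapCapped`, `HistoryTailL`, the rung R3, d = 4, a continuum limit or a
mass gap is proved.  YM₃ on T³ is rung R3, NOT Clay.  References: T. Bałaban, CMP **98** (1985) 17–51 [Balaban1985Averaging] ((9) p.19,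
(19)–(20) p.21, p.24); CMP **102** (1985) 255–275 [Balaban1985UV3] ((27) p.263 the contour).  Elementary ([folklore]).
-/

noncomputable section

namespace Summit.QuantumFields.YangMills.Theorems.CovariantDischargeCombLassoStokes

open Literature.MathematicalPhysics.QuantumFieldTheory.Balaban1983to89
open Literature.MathematicalPhysics.QuantumFieldTheory.Balaban1983to89.B10Eq27TorusAxialLog
  (transl rel rel_transl_of_mem axialT contourT contourT_eq holT holT_eq_holAt holT_contourT_eq_gaugeActT gaugeActT_eq_gaugeAct)
open Literature.MathematicalPhysics.QuantumFieldTheory.Balaban1983to89.B7Prop1Explicit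
  (Letter e treeWord disp disp_append disp_treeWord disp_revWord disp_cons disp_nil revWord length_revWord length_treeWord l1
    l1_add_le l1_vec)
open Literature.MathematicalPhysics.QuantumFieldTheory.Balaban1983to89.BlockAveragingZd (disp_eq_netDisp)
open Literature.MathematicalPhysics.QuantumFieldTheory.Balaban1983to89.LatticeWordStokes (dist1_holAt_le_of_netDisp_eq_zero)

variable {P : Params} {j : ℕ}

/-- **THE LASSO WORD IS CLOSED**: `netDisp (Γ_{c,b₋} ++ [b] ++ Γ_{c,b₊}⁻¹) = 0`. [cite: Balaban1985UV3, (27) p.263] -/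
theorem netDisp_contourT (c : Site P j) (b : PBond P j) : ∀ ν, T4Continuum.netDisp (contourT c b) ν = 0 := by
  intro ν
  rw [← disp_eq_netDisp, contourT_eq, disp_append, disp_append, disp_treeWord, disp_revWord, disp_treeWord, disp_cons, disp_nil]
  simp

/-- Length of the lasso word: `|Γ_{c,b₋}| + 1 + |Γ_{c,b₊}|` (`ℓ¹` lengths of the relative positions; also landed as
`GlobalSlackKernelLeg.length_contourT`, kept private here to avoid a cross-lane import). [cite: Balaban1985UV3, (27) p.263] -/
private theorem length_contourT (c : Site P j) (b : PBond P j) :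
    (contourT c b).length = l1 (rel c b.src) + 1 + l1 (rel c b.src + e b.dir) := by
  rw [contourT_eq, List.length_append, List.length_append, length_treeWord, List.length_singleton, length_revWord, length_treeWord]

/-- `|z|₁ ≤ d·r` when `‖z‖_∞ ≤ r`. [folklore] -/
theorem l1_le_of_natAbs_le {d : ℕ} {z : Fin d → ℤ} {r : ℕ} (hz : ∀ ν, (z ν).natAbs ≤ r) : l1 z ≤ d * r := by
  unfold l1
  calc ∑ κ, (z κ).natAbs ≤ ∑ _κ : Fin d, r := Finset.sum_le_sum fun κ _ => hz κ
    _ = d * r := by simp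

section Stokes

variable {G : Type*} [GaugeGroup G]

/-- ★★ **THE COMB-LASSO STOKES LETTER**: if every plaquette of `V` is within `δ` of `1` and the bond `b` does not wrap around the torus seen
from `c`, the comb-re-gauged letter satisfies `dist1 (V^{axialT V c}(b)) ≤ ((|Γ_{c,b₋}| + 1 + |Γ_{c,b₊}|)²/4)·δ`.
[cite: Balaban1985Averaging, (19)-(20) p.21, p.24; Balaban1985UV3, (27) p.263] -/
theorem dist1_gaugeAct_axialT_le {δ : ℝ} (hδ : 0 ≤ δ) {V : GaugeField P j G} (hV : PlaqSmall δ V) (c : Site P j) (b : PBond P j)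
    (hwrap : (rel c b.src b.dir + 1) * 2 ≤ (P.sitesPerDir j : ℤ)) :
    dist1 (GaugeField.gaugeAct (axialT V c) V b) ≤
      (((l1 (rel c b.src) + 1 + l1 (rel c b.src + e b.dir) : ℕ) : ℝ) ^ 2 / 4) * δ := by
  rw [← gaugeActT_eq_gaugeAct, ← holT_contourT_eq_gaugeActT V c b hwrap, holT_eq_holAt, ← length_contourT]
  exact dist1_holAt_le_of_netDisp_eq_zero V hδ hV _ _ rfl (netDisp_contourT c b) c

/-- ★★ **THE SAME ON A BALL, UNIFORMLY**: for `b.src = c + z`, `‖z‖_∞ ≤ r`, `2(r+1) ≤` period (no wrap), every plaquette within `δ`: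
`dist1 (V^{axialT V c}(b)) ≤ ((2dr + 2)²/4)·δ = (dr + 1)²·δ` — the `η_R` of the B6 door. [cite: Balaban1985Averaging, (19)-(20) p.21, p.24] -/
theorem dist1_gaugeAct_axialT_le_of_ball {δ : ℝ} (hδ : 0 ≤ δ) {V : GaugeField P j G} (hV : PlaqSmall δ V) (c : Site P j) {r : ℕ}
    (hr : 2 * (r + 1) ≤ P.sitesPerDir j) {z : Fin P.d → ℤ} (hz : ∀ ν, (z ν).natAbs ≤ r) (b : PBond P j) (hb : b.src = transl c z) :
    dist1 (GaugeField.gaugeAct (axialT V c) V b) ≤ (((2 * P.d * r + 2 : ℕ) : ℝ) ^ 2 / 4) * δ := by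
  have hwin : ∀ ν, z ν * 2 ∈ Set.Ioc (-(P.sitesPerDir j : ℤ)) (P.sitesPerDir j) := fun ν => by
    have h := hz ν; constructor <;> omega
  have hrel : rel c b.src = z := by rw [hb, rel_transl_of_mem c z hwin]
  have hwrap : (rel c b.src b.dir + 1) * 2 ≤ (P.sitesPerDir j : ℤ) := by
    rw [hrel]; have h := hz b.dir; omega
  refine (dist1_gaugeAct_axialT_le hδ hV c b hwrap).trans (mul_le_mul_of_nonneg_right ?_ hδ)
  have hlen : l1 (rel c b.src) + 1 + l1 (rel c b.src + e b.dir) ≤ 2 * P.d * r + 2 := by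
    rw [hrel]
    have h1 : l1 z ≤ P.d * r := l1_le_of_natAbs_le hz
    have h2 : l1 (z + e b.dir) ≤ P.d * r + 1 := by
      have := l1_add_le z (e b.dir)
      have h3 : l1 (e b.dir) = 1 := by
        have := l1_vec ((b.dir, true) : Letter P.d); rwa [Letter.vec_true] at this
      omega
    have e3 : 2 * P.d * r = 2 * (P.d * r) := by ring
    rw [e3]; omega
  have hcast : ((l1 (rel c b.src) + 1 + l1 (rel c b.src + e b.dir) : ℕ) : ℝ) ≤ ((2 * P.d * r + 2 : ℕ) : ℝ) := by
    exact_mod_cast hlen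
  have h0 : (0 : ℝ) ≤ ((l1 (rel c b.src) + 1 + l1 (rel c b.src + e b.dir) : ℕ) : ℝ) := by positivity
  have := mul_le_mul hcast hcast h0 ((h0.trans hcast))
  nlinarith

end Stokes

end Summit.QuantumFields.YangMills.Theorems.CovariantDischargeCombLassoStokes

end
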